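import Summits.CriticalPhenomena.Ising3D.Control2DL19GapCCellsA
import Summits.CriticalPhenomena.Ising3D.Control2DL19GapCCellsB
import Summits.CriticalPhenomena.Ising3D.Control2DL19GapCCellsC
import Summits.CriticalPhenomena.Ising3D.Control2DL19GapCCellsD
import Summits.CriticalPhenomena.Ising3D.Control2DBoxCells
import Mathlib.Tactic.IntervalCases
import Mathlib.Tactic.Linarith
import Mathlib.Tactic.NormNum
import HarnessLib

/-!
# Kernel replay of the RB-1 certificate `j129766_functional_deriv2d_L19_E048_eps1.00005.json` (Λ = 19, E₀ = 48): Δ_ε < 20001/20000 at Δ_σ = 1/8: the cells as ONE theorem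
(cell `pub-ising3x`, seat controls-1 gen 19; KERNEL PATH for the 2D γ-certificates, Λ = 19 — CONTROL-ONLY)

HONEST FRAMING: lottery ticket; floor = tightest certified 3D Ising CFT bounds; no exact-solution
claim without a proof. CONTROL-ONLY (`d = 2`, `Δ_σ = 1/8`).

`cells_gapC`: every cell obligation of the certificate (scalars on [U, E₀), even spins ≥ 2 on [ℓ, E₀); E₀ = 48), in the
witness form `∃ N ≥ E₀` with the spin's own truncation order, from the per-spin cell lemmas `cellSpan_gapC_sℓ`
(`Control2DL19GapCCellsA`, `Control2DL19GapCCellsB`, `Control2DL19GapCCellsC`, `Control2DL19GapCCellsD`). No facts, standard axioms only.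
-/

namespace Summit.CriticalPhenomena.Ising3D.Control2D

open Finset Set
open Literature.MathematicalPhysics.QuantumFieldTheory.ConformalBootstrap3D

set_option maxHeartbeats 0 in
set_option maxRecDepth 200000 in
/-- **The cells of the certificate** (Δ_ε < 20001/20000 at Δ_σ = 1/8; `E₀ = 48`; truncation `N = Nd + 1` per spin:
ℓ=0: 72, ℓ=2: 72, ℓ=4: 72, ℓ=6: 72, ℓ=8: 72, ℓ=10: 72, ℓ=12: 64, ℓ=14: 64, ℓ=16: 64; others `N = 48`). [folklore] -/
theorem cells_gapC :
    GapCellsN slL19.toFinset (fun p => (wtgapC p : ℝ)) (1 / 8) (20001 / 20000) 48 := by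
  refine ⟨?_, ?_⟩
  · intro Δ h1 h2
    exact ⟨71 + 1, by norm_num, cellSpan_gapC_s0 h1 h2.le⟩
  · intro ℓ hℓ hℓ0 Δ hℓΔ hΔ
    have hℓR : (ℓ : ℝ) < 48 := lt_of_le_of_lt hℓΔ hΔ
    have hℓE : ℓ < 48 := by exact_mod_cast hℓR
    interval_cases ℓ
    · exact absurd rfl hℓ0
    · exact absurd hℓ (by decide)
    · exact ⟨71 + 1, by norm_num, cellSpan_gapC_s2 (by exact_mod_cast hℓΔ) hΔ.le⟩
    · exact absurd hℓ (by decide)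
    · exact ⟨71 + 1, by norm_num, cellSpan_gapC_s4 (by exact_mod_cast hℓΔ) hΔ.le⟩
    · exact absurd hℓ (by decide)
    · exact ⟨71 + 1, by norm_num, cellSpan_gapC_s6 (by exact_mod_cast hℓΔ) hΔ.le⟩
    · exact absurd hℓ (by decide)
    · exact ⟨71 + 1, by norm_num, cellSpan_gapC_s8 (by exact_mod_cast hℓΔ) hΔ.le⟩
    · exact absurd hℓ (by decide)
    · exact ⟨71 + 1, by norm_num, cellSpan_gapC_s10 (by exact_mod_cast hℓΔ) hΔ.le⟩
    · exact absurd hℓ (by decide)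
    · exact ⟨63 + 1, by norm_num, cellSpan_gapC_s12 (by exact_mod_cast hℓΔ) hΔ.le⟩
    · exact absurd hℓ (by decide)
    · exact ⟨63 + 1, by norm_num, cellSpan_gapC_s14 (by exact_mod_cast hℓΔ) hΔ.le⟩
    · exact absurd hℓ (by decide)
    · exact ⟨63 + 1, by norm_num, cellSpan_gapC_s16 (by exact_mod_cast hℓΔ) hΔ.le⟩
    · exact absurd hℓ (by decide)
    · exact ⟨47 + 1, by norm_num, cellSpan_gapC_s18 (by exact_mod_cast hℓΔ) hΔ.le⟩
    · exact absurd hℓ (by decide)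
    · exact ⟨47 + 1, by norm_num, cellSpan_gapC_s20 (by exact_mod_cast hℓΔ) hΔ.le⟩
    · exact absurd hℓ (by decide)
    · exact ⟨47 + 1, by norm_num, cellSpan_gapC_s22 (by exact_mod_cast hℓΔ) hΔ.le⟩
    · exact absurd hℓ (by decide)
    · exact ⟨47 + 1, by norm_num, cellSpan_gapC_s24 (by exact_mod_cast hℓΔ) hΔ.le⟩
    · exact absurd hℓ (by decide)
    · exact ⟨47 + 1, by norm_num, cellSpan_gapC_s26 (by exact_mod_cast hℓΔ) hΔ.le⟩
    · exact absurd hℓ (by decide)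
    · exact ⟨47 + 1, by norm_num, cellSpan_gapC_s28 (by exact_mod_cast hℓΔ) hΔ.le⟩
    · exact absurd hℓ (by decide)
    · exact ⟨47 + 1, by norm_num, cellSpan_gapC_s30 (by exact_mod_cast hℓΔ) hΔ.le⟩
    · exact absurd hℓ (by decide)
    · exact ⟨47 + 1, by norm_num, cellSpan_gapC_s32 (by exact_mod_cast hℓΔ) hΔ.le⟩
    · exact absurd hℓ (by decide)
    · exact ⟨47 + 1, by norm_num, cellSpan_gapC_s34 (by exact_mod_cast hℓΔ) hΔ.le⟩
    · exact absurd hℓ (by decide)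
    · exact ⟨47 + 1, by norm_num, cellSpan_gapC_s36 (by exact_mod_cast hℓΔ) hΔ.le⟩
    · exact absurd hℓ (by decide)
    · exact ⟨47 + 1, by norm_num, cellSpan_gapC_s38 (by exact_mod_cast hℓΔ) hΔ.le⟩
    · exact absurd hℓ (by decide)
    · exact ⟨47 + 1, by norm_num, cellSpan_gapC_s40 (by exact_mod_cast hℓΔ) hΔ.le⟩
    · exact absurd hℓ (by decide)
    · exact ⟨47 + 1, by norm_num, cellSpan_gapC_s42 (by exact_mod_cast hℓΔ) hΔ.le⟩
    · exact absurd hℓ (by decide)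
    · exact ⟨47 + 1, by norm_num, cellSpan_gapC_s44 (by exact_mod_cast hℓΔ) hΔ.le⟩
    · exact absurd hℓ (by decide)
    · exact ⟨47 + 1, by norm_num, cellSpan_gapC_s46 (by exact_mod_cast hℓΔ) hΔ.le⟩
    · exact absurd hℓ (by decide)

end Summit.CriticalPhenomena.Ising3D.Control2D
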